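import Summits.SmoothPoincare4.SmoothPoincare4.Theses.SymplecticOrigami
import Summits.SmoothPoincare4.SmoothPoincare4.Theses.SchoenfliesSplit
import Literature.Topology.FourManifolds.CerfGammaFourProofs
import Literature.Topology.FourManifolds.BallGluingUniqueness
import Literature.Topology.FourManifolds.RadialExtension
import Literature.Topology.FourManifolds.CerfTheoremOne
import Literature.Topology.FourManifolds.SmoothOrientationSphereProofs
import Literature.Topology.FourManifolds.SmoothOrientationDiffeomorphProofs
import Literature.Geometry.Symplectic.GromovR4RelEnd
import HarnessLib

/-!
# Crux SchsplitCerf / CerfGammaFour (stmt-SmoothPoincare4-8758) — ideator 1 sketch (round 1)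

First lemmas of the two crux idea cards `contact-isotopy-gromov-cone` and
`eliashberg-levi-flat-discs`, typed over existing tree declarations, plus the
KERNEL-CHECKED glue  K1 ∧ K2 ⟹ `cerf_diffeomorph_sphere_three_extends_ball` ⟹ crux (both route
decls), so that a crux-plan seat only has to register the analytic stubs.

* K1 `ContactRepresentative` — Eliashberg 1992 Thm 2.1.1 + Bennequin 1983 + Gray: every
  orientation-preserving diffeomorphism of `S³` is, up to a diffeotopically trivial factor, a
  positive contactomorphism of the standard contact form `α₀_z(v) = ½ ω₀(z, v)` (named-fact shape).
* K2 `ContactomorphismsExtend` — positive contactomorphisms of `(S³, ξ₀)` extend over `D⁴`.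
  Card 1 proves it from the tree's `gromov_recognitionR4_relEnd` applied to
  `(ℝ⁴, S^*ω₀, cone_φ)`; card 2 from Levi-flat (Bedford–Gaveau) fillings in the honest ball plus
  the level-preserving lemma `LevelPreservingExtend`.
-/

noncomputable section

open scoped Manifold ContDiff Topology
open Set Function Metric
open Literature.Topology.FourManifolds Literature.Geometry.Symplectic

namespace Summit.SmoothPoincare4.SmoothPoincare4.Cruxes.SchsplitCerf.SketchIdeator1

/-- The unit 3-sphere. -/
local notation "𝕊³" => (Metric.sphere (0 : EuclideanSpace ℝ (Fin 4)) 1)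
/-- The model `ℝ⁴`. -/
local notation "E4" => EuclideanSpace ℝ (Fin 4)

/-! ## The contactomorphism condition, in coordinates of `ℝ⁴ ⊃ S³` -/

/-- `φ` is a POSITIVE contactomorphism of the standard contact structure of `S³ ⊂ (ℝ⁴, ω₀)` with
conformal factor `exp ∘ u`: for the standard contact form `α₀_z(v) = ½ ω₀(z, v)` (`ω₀` =
`stdSymplecticForm`, tangent vectors read in `ℝ⁴` through the differential of the inclusion),
`φ^* α₀ = e^u α₀`, `u` smooth. -/
def IsStdContacto (φ : 𝕊³ ≃ₘ⟮𝓡 3, 𝓡 3⟯ 𝕊³) (u : 𝕊³ → ℝ) : Prop :=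
  ContMDiff (𝓡 3) 𝓘(ℝ, ℝ) ∞ u ∧
    ∀ (z : 𝕊³) (v : TangentSpace (𝓡 3) z),
      stdSymplecticForm ((φ z : 𝕊³) : E4)
          (mfderiv (𝓡 3) 𝓘(ℝ, E4) (fun w : 𝕊³ => ((φ w : 𝕊³) : E4)) z v) =
        Real.exp (u z) *
          stdSymplecticForm ((z : 𝕊³) : E4)
            (mfderiv (𝓡 3) 𝓘(ℝ, E4) (fun w : 𝕊³ => ((w : 𝕊³) : E4)) z v)

/-- **K2 (ContactomorphismsExtend).** Every positive contactomorphism of `(S³, ξ₀)` extends to a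
diffeomorphism of the closed 4-ball (`ExtendsOverBall 3 φ`, `CerfGammaFourProofs.lean`). -/
def ContactomorphismsExtend : Prop :=
  ∀ (φ : 𝕊³ ≃ₘ⟮𝓡 3, 𝓡 3⟯ 𝕊³) (u : 𝕊³ → ℝ), IsStdContacto φ u → ExtendsOverBall 3 φ

/-- **K1 (ContactRepresentative) = Geiges 2008, Lemma 4.11.1 verbatim** ("Any
orientation-preserving diffeomorphism `f` of `S³` is isotopic to a diffeomorphism `g` preserving
the standard contact structure `ξ_st`"; proof there: `Tf(ξ_st)` is positive and tight
(Cor. 6.5.10), hence isotopic to `ξ_st` (Thm. 4.10.1 (a)/4.10.3, Eliashberg 1992), and Gray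
stability (Thm. 2.2.2)), with the conformal factor made explicit and POSITIVE (coorientation; if
`g^*α₀ = -e^u α₀` compose with `(z₁,z₂) ↦ (z̄₁,z̄₂) ∈ SO(4)`, diffeotopic to `id`). Named-fact
shape: for every smooth orientation `o` of `S³` and every `o`-preserving `f` there are `g`
diffeotopic to `f` and `u` smooth with `g^*α₀ = e^u α₀`. -/
def ContactRepresentative : Prop :=
  ∀ (o : SmoothOrientation (𝓡 3) 𝕊³) (f : 𝕊³ ≃ₘ⟮𝓡 3, 𝓡 3⟯ 𝕊³),
    f.IsOrientationPreserving o o →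
      ∃ (g : 𝕊³ ≃ₘ⟮𝓡 3, 𝓡 3⟯ 𝕊³) (u : 𝕊³ → ℝ),
        Diffeomorph.IsDiffeotopic g f ∧ IsStdContacto g u

/-! ## Card 1: the cone of `φ` and the radial stretch (first lemma) -/

/-- The cone `cone_φ(x) = ‖x‖ · φ(x/‖x‖)` of a self-map of `S³` (junk value `0` at `0`): the
φ-twisted END CHART of `ℝ⁴`. -/
def coneMap (φ : 𝕊³ → 𝕊³) (x : E4) : E4 :=
  if hx : x = 0 then 0
  else ‖x‖ • ((φ ⟨‖x‖⁻¹ • x, by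
    rw [mem_sphere_zero_iff_norm, norm_smul, norm_inv, norm_norm,
      inv_mul_cancel₀ (norm_ne_zero_iff.mpr hx)]⟩ : 𝕊³) : E4)

/-- **First lemma of card `contact-isotopy-gromov-cone` (K2a, the only analysis in the line):**
for a positive contactomorphism `φ` with factor `e^u` there are a self-diffeomorphism `S` of `ℝ⁴`
(the radial stretch `S(e^s z) = e^{s + β(s) u(z)/2} z`), equal to the identity on the unit ball,
and a radius `R`, such that on `{R < ‖x‖}` the pullbacks of `ω₀` by `S` and by `cone_φ` coincide:
`ω₀(DS v, DS w) = ω₀(D cone_φ v, D cone_φ w)`. (Both equal `d(r² e^u α₀)`: `cone_φ^*λ₀ = r² φ^*α₀`,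
`S^*λ₀ = r² e^u α₀`, and `F^*ω₀(v,w) = D_v[F^*λ₀ w] - D_w[F^*λ₀ v]`.) Hence `sf := S^*ω₀` is a
symplectic form on `M := ℝ⁴` standard at infinity for the end chart `ψ := cone_φ`, and the ten
hypotheses of `gromov_recognitionR4_relEnd` hold with `K := closedBall 0 R`, `χ := cone_{φ⁻¹}`. -/
theorem stretch_eq_cone_pullback (φ : 𝕊³ ≃ₘ⟮𝓡 3, 𝓡 3⟯ 𝕊³) (u : 𝕊³ → ℝ)
    (h : IsStdContacto φ u) :
    ∃ (S : E4 ≃ₘ⟮𝓡 4, 𝓡 4⟯ E4) (R : ℝ), 0 < R ∧ (∀ x : E4, ‖x‖ ≤ 1 → S x = x) ∧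
      (∀ x : E4, ∃ c : ℝ, 0 < c ∧ S x = c • x) ∧
      ∀ x : E4, R < ‖x‖ → ∀ v w : E4,
        stdSymplecticForm (fderiv ℝ S x v) (fderiv ℝ S x w) =
          stdSymplecticForm (fderiv ℝ (coneMap φ) x v) (fderiv ℝ (coneMap φ) x w) := by
  sorry

/-- **K2 from Gromov's relative recognition of `ℝ⁴`** (card 1): `gromov_recognitionR4_relEnd`
applied to `(ℝ⁴, S^*ω₀, cone_φ)` returns `Φ : ℝ⁴ ≃ₘ ℝ⁴` with `Φ = cone_φ` off a compact set;
`Φ` preserves a large ball `B̄(0, R'')` and `x ↦ R''⁻¹ Φ (R'' x)` is a diffeomorphism of `𝔻⁴`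
restricting to `φ` on `S³`. -/
theorem contactomorphismsExtend_of_gromov (hG : gromov_recognitionR4_relEnd) :
    ContactomorphismsExtend := by
  sorry

/-! ## Card 2: level-preserving diffeomorphisms extend (first lemma) -/

/-- The height `h(z) = z₃` on `S³ ⊂ ℝ⁴`; its levels are the round 2-spheres `S_t`, `t ∈ (-1,1)`,
each with exactly two complex tangencies `(0,0,±√(1-t²), t)`… in the complex coordinates
`z₁ = x₀ + i x₁`, `z₂ = x₂ + i x₃` the level `S_t = {Im z₂ = t}` bounds the flat Levi-flat 3-ball
`{Im z₂ = t} ∩ 𝔻⁴` foliated by the holomorphic discs `{z₂ = s + it}`. -/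
def height (z : 𝕊³) : ℝ := (z : E4) 3

/-- **First lemma of card `eliashberg-levi-flat-discs` (the Smale correction, π₁-level):** a
self-diffeomorphism of `S³` preserving every level sphere `S^t = {y₂ = t}` of the height and equal
to the identity near the two poles extends over `𝔻⁴`. (It is a loop `t ↦ g_t ∈ Diff⁺(S²)` based
at `id`; by Smale's theorem at the `π₁` level the loop deforms to a loop of rotations, and a loop of
rotations acting levelwise is diffeotopic to `id` in `Diff(S³)` — contract it through paths with
one free end; then Cerf's Lemma 2 `ExtendsOverBall.of_isDiffeotopicToId`.) Geiges 2008, end of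
the proof of Prop. 4.11.2 (the 2-parameter extension problem for `ρ₂ : Diff(D²) → Diff(S¹)`,
fibre contractible by Smale 1959) is the printed form of the same step. -/
def LevelPreservingExtend : Prop :=
  ∀ g : 𝕊³ ≃ₘ⟮𝓡 3, 𝓡 3⟯ 𝕊³, (∀ z, height (g z) = height z) →
    (∃ δ : ℝ, 0 < δ ∧ ∀ z, 1 - δ < |height z| → g z = z) → ExtendsOverBall 3 g

/-- **Levi-flat filling, END RESULT of Geiges 2008 pp. 256–257 (proof of Prop. 4.11.2 =
Eliashberg 1992; filling by holomorphic discs: Bedford–Gaveau 1983, Gromov 1985 2.4.D,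
Eliashberg 1990) in purely differential-topological form:** for a positive contactomorphism `φ`
(after a contact isotopy making it the identity near the poles, contact disc theorem Thm. 2.6.7)
the images `φ(S^t)` of the level spheres have exactly the two elliptic complex points `φ(q^t_±)`,
their punctured complements are foliated by circles bounding holomorphic discs in the honest
`(𝔻⁴, i)` which foliate `𝔻⁴` (off two arcs), and matching this foliation with the flat one
(`x₂ = s` on `S^t`, discs `𝔻⁴ ∩ (ℂ × {s + it})`) — after the isotopy ALONG THE LEAVES of the
characteristic foliation that carries `φ(𝔠_t)` to the disc-boundary foliation (both transverse to
it, Lemma 4.11.3) — yields a diffeomorphism of `𝔻⁴` whose boundary value is `φ ∘ g` with `g`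
LEVEL-PRESERVING and the identity near the poles. -/
def LeviFlatFillingOutput : Prop :=
  ∀ (φ : 𝕊³ ≃ₘ⟮𝓡 3, 𝓡 3⟯ 𝕊³) (u : 𝕊³ → ℝ), IsStdContacto φ u →
    ∃ g : 𝕊³ ≃ₘ⟮𝓡 3, 𝓡 3⟯ 𝕊³, (∀ z, height (g z) = height z) ∧
      (∃ δ : ℝ, 0 < δ ∧ ∀ z, 1 - δ < |height z| → g z = z) ∧ ExtendsOverBall 3 (g.trans φ)

/-- **K2 from the Levi-flat filling and the Smale correction** (card 2; pure group theory in
`Ext = image (Diff 𝔻⁴ → Diff S³)`: `φ = (φ ∘ g) ∘ g⁻¹`). -/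
theorem contactomorphismsExtend_of_leviFlat (hF : LeviFlatFillingOutput)
    (hL : LevelPreservingExtend) : ContactomorphismsExtend := by
  intro φ u hφ
  obtain ⟨g, hg, hpole, hext⟩ := hF φ u hφ
  have key : φ = g.symm.trans (g.trans φ) := Diffeomorph.ext fun x => by simp
  rw [key]
  exact (hL g hg hpole).symm.trans hext

/-! ## Glue (kernel-checked): K1 ∧ K2 ⟹ Γ₄ = 0 in extension form ⟹ the crux, by name -/

/-- **K1 ∧ K2 ⟹ every self-diffeomorphism of `S³` extends over `D⁴`** (Geiges 2008 §1.7.1,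
last paragraph: "sweeping out the isotopy between f and f₀ over a collar", in the tree
`ExtendsOverBall.of_isDiffeotopic` = Cerf's Lemma 2). Orientation-preserving `φ`: `g ∈ Ext` by K2
and `φ` is diffeotopic to `g`. Orientation-reversing `φ`: apply the same to `φ ∘ ρ`, `ρ` a
hyperplane reflection, which extends linearly (`extendsOverBall_sphereReflection`; Geiges's
footnote to §1.7.1). -/
theorem cerf_extends_of_contact (h1 : ContactRepresentative) (h2 : ContactomorphismsExtend) :
    cerf_diffeomorph_sphere_three_extends_ball := by
  intro φ
  obtain ⟨o, -⟩ := exists_smoothOrientation_sphere 3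
  haveI : ConnectedSpace 𝕊³ := by
    refine isConnected_iff_connectedSpace.mp (isConnected_sphere ?_ 0 zero_le_one)
    rw [← Module.finrank_eq_rank, finrank_euclideanSpace_fin]
    norm_num
  -- the orientation-preserving case, for any `θ`
  have hpos : ∀ θ : 𝕊³ ≃ₘ⟮𝓡 3, 𝓡 3⟯ 𝕊³, θ.IsOrientationPreserving o o → ExtendsOverBall 3 θ := by
    intro θ hθ
    obtain ⟨g, u, hg, hu⟩ := h1 o θ hθ
    exact (h2 g u hu).of_isDiffeotopic hg
  rcases Diffeomorph.isOrientationPreserving_or_isOrientationReversing_holds φ (by simp) o o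
    with hφ | hφ
  · exact hpos φ hφ
  · set v : 𝕊³ := sphereBasePoint 3
    have hρ : IsOrientationPreserving o (-o) ⇑(sphereReflection v) :=
      sphereReflection_isOrientationReversing_of_ne_zero three_ne_zero v o
    have hφ' : IsOrientationPreserving (-o) o ⇑φ := by
      rw [← isOrientationPreserving_neg_neg_iff, neg_neg]
      exact hφ
    have hcomp : ((sphereReflection v).trans φ).IsOrientationPreserving o o := by
      show IsOrientationPreserving o o ⇑((sphereReflection v).trans φ)
      rw [Diffeomorph.coe_trans]
      exact IsOrientationPreserving.comp_holds hφ' hρ (φ.mdifferentiable (by simp))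
        ((sphereReflection v).mdifferentiable (by simp))
        (fun y => φ.det_mfderiv_ne_zero (by simp) y)
        (fun x => (sphereReflection v).det_mfderiv_ne_zero (by simp) x)
    have hext : ExtendsOverBall 3 ((sphereReflection v).trans φ) := hpos _ hcomp
    have key : φ = (sphereReflection v).symm.trans ((sphereReflection v).trans φ) :=
      Diffeomorph.ext fun x => by
        simp only [Diffeomorph.coe_trans, Function.comp_apply, Diffeomorph.apply_symm_apply]
    rw [key]
    exact (extendsOverBall_sphereReflection v).symm.trans hext

/-- **The crux of route SymplecticOrigami, by name, from K1 ∧ K2** (via the tree's proved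
`cerf_twistedSphere_four_of_extends''`). -/
theorem cerfGammaFour_of_contact (h1 : ContactRepresentative) (h2 : ContactomorphismsExtend) :
    Summit.SmoothPoincare4.SmoothPoincare4.Theses.SymplecticOrigami.CerfGammaFour :=
  cerf_twistedSphere_four_of_extends'' (cerf_extends_of_contact h1 h2)

/-- **The crux of route SchoenfliesSplit, by name, from K1 ∧ K2.** -/
theorem schsplitCerf_of_contact (h1 : ContactRepresentative) (h2 : ContactomorphismsExtend) :
    Summit.SmoothPoincare4.SmoothPoincare4.Theses.SchoenfliesSplit.SchsplitCerf :=
  cerf_twistedSphere_four_of_extends'' (cerf_extends_of_contact h1 h2)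

/-- **Card 1 composed:** Gromov rel-end (in-tree named fact, SymplecticOrigami item 11009) ∧ K1
⟹ the crux. -/
theorem cerfGammaFour_of_gromov (hG : gromov_recognitionR4_relEnd) (h1 : ContactRepresentative) :
    Summit.SmoothPoincare4.SmoothPoincare4.Theses.SymplecticOrigami.CerfGammaFour :=
  cerfGammaFour_of_contact h1 (contactomorphismsExtend_of_gromov hG)

/-- **Card 2 composed:** Levi-flat filling output ∧ level-preserving lemma ∧ K1 ⟹ the crux. -/
theorem cerfGammaFour_of_leviFlat (hF : LeviFlatFillingOutput) (hL : LevelPreservingExtend)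
    (h1 : ContactRepresentative) :
    Summit.SmoothPoincare4.SmoothPoincare4.Theses.SymplecticOrigami.CerfGammaFour :=
  cerfGammaFour_of_contact h1 (contactomorphismsExtend_of_leviFlat hF hL)

end Summit.SmoothPoincare4.SmoothPoincare4.Cruxes.SchsplitCerf.SketchIdeator1

end
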